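import Summits.Schanuel.Schanuel.Theorems.DiophantineDichotomyApproximationPropertyDeficientLeverDefs
import Summits.Schanuel.Schanuel.Theorems.DiophantineDichotomyApproximationPropertyPointDatumOfClause
import HarnessLib

/-!
# Stub `pointDatum_of_nearClause` of line `orbit-interpolation-determinant` (stmt-Schanuel-6117)

Route `DiophantineDichotomy`, crux
`Summit.Schanuel.Schanuel.Theses.DiophantineDichotomy.ApproximationProperty` (stmt-Schanuel-6117),
line `orbit-interpolation-determinant`, registered stub `pointDatum_of_nearClause` (vocabulary in
`Theorems/DiophantineDichotomyApproximationPropertyDefs.lean` and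
`Theorems/DiophantineDichotomyApproximationPropertyDeficientLeverDefs.lean`) — the PER-SCALE
good-orbit transfer in every dimension `t ≥ 1` under the NEAR-clause of the deficient lever
(memo `Cruxes/ApproximationProperty/KERNEL-c8.md` §4): assuming `ZeroDimDictionary` and
`SharpClosestPointDeficient`, for every `ω ∈ ℂᵗ`, `c₁ ≥ 1` and `K₀ ≥ 1` there are a boost `λ ≥ 1`
and a constant `c ≥ c₁` (depending on `t, ω, c₁, K₀` and on the constants of the two hypotheses
only) such that for `Y ≥ Δ ≥ c` and ONE homogeneous PRIME `𝔭 ⊂ ℚ[x₀, …, x_t]` of rank `1` with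
`deg 𝔭 ≤ (c₁Δ)ᵗ`, `h(𝔭) ≤ c₁ λY Δᵗ⁻¹`, `|𝔭(1:ω)| ≤ exp(−(Δ h(𝔭) + λY deg 𝔭)/c₁)` and the
near-clause `deg 𝔭 + K₀ · dim(ℚ[x]_δ ∩ 𝔭) ≤ K₀ · dim ℚ[x]_δ` at `δ = ⌊c₁Δ⌋` (the orbit imposes
at least `deg 𝔭 / K₀` conditions on the forms of degree `δ`), there are a number field `K`,
`β ∈ Kᵗ` and `σ : K →+* ℂ` with `[K:ℚ] ≤ (cΔ)ᵗ`, `h_K(1:β) ≤ c Y Δᵗ⁻¹` and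
`‖σ(β) − ω‖ ≤ exp(−(Δ h_K(1:β) + Y [K:ℚ])/c)` (a `PointAPAbsAt t`-datum at `(Δ, Y)`).

This is the landed transfer `pointDatum_of_clause`
(`Theorems/DiophantineDichotomyApproximationPropertyPointDatumOfClause.lean`) with
`SharpClosestPoint` replaced by `SharpClosestPointDeficient` instantiated at `K₀` and the
interpolation clause replaced by the near-clause, which is handed to the sharp property
unchanged. To share the argument we prove it ONCE for an arbitrary clause predicate
`P 𝔭 δ` (`PointDatumNear.main_of_sharpWith`: the transfer at `δ = ⌊c₁Δ⌋` with `ℓ` so large that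
`2c₁²C ≤ ℓ^{1/t}` and the boost `λ ≥ 2c₁²C'(t+2)(log(2+‖ω‖)+1)`, then
`PhilipponMain.affine_near_of_projDist_le` and `ZeroDimDictionary` give the field `K = ℚ(b)`, the
affine point `(b₁/b₀, …, b_t/b₀)`, the embedding and the three budgets — all bookkeeping lemmas
are the landed `PointDatum.*`), and specialise `P` to the near-clause. Sources:
NesterenkoPhilippon2001 (LNM 1752) Ch. 3 §4 (Prop. 4.4, p. 38), Ch. 4 §4 (p. 61); Philippon 1986
(Publ. Math. IHÉS 64) §3.
-/

set_option linter.dupNamespace false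

noncomputable section

attribute [local instance] MvPolynomial.gradedAlgebra

namespace Summit.Schanuel.Schanuel.Cruxes.ApproximationProperty.OrbitInterpolationDeterminant

open Literature.NumberTheory.Transcendental Literature.NumberTheory.Transcendental.Nesterenko
  Literature.NumberTheory.Transcendental.PhilipponMain MvPolynomial Real

namespace PointDatumNear

/-- **The per-scale good-orbit transfer for an arbitrary clause predicate `P`.** For `ω ∈ ℂᵗ` and
`c₁ ≥ 1` and a sharp closest-point property RELATIVE TO `P` (constants `C > 0`, `ℓ₀`, and for
`ℓ ≥ ℓ₀` a `C' > 0`: every homogeneous prime `𝔭` of rank `1` with `P 𝔭 δ` has a zero `β` with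
`dist((1:ω), β)^ℓ ≤ |𝔭(1:ω)| e^{C δ h(𝔭)/ℓ^{1/t} + C' deg 𝔭 ((δ+1)(log(2+‖ω‖)+1) + log(deg 𝔭+1))}`;
`SharpClosestPoint t` is the interpolation clause, `SharpClosestPointDeficient t K₀` the
near-clause): constants `c_d` (dictionary), `C, ℓ₀` (transfer);
`ℓ = max(ℓ₀, 1, ⌈(2c₁²C)ᵗ⌉)` (the `δ h(𝔭)/ℓ^{1/t}` tail is `≤ Δ h(𝔭)/(2c₁)`), then `C'(ℓ)`, the
boost `λ = max(1, 2c₁²C'(t+2)(log(2+‖ω‖) + 1))` (the `deg 𝔭 · Δ` terms are `≤ λ Y deg 𝔭/(2c₁)`),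
then `c = c₁ + (c₁λ + c_d c₁ᵗ) + 4M(c_d+1) + 4M log(2Θ²)`, `M = c₁ℓ`, `Θ = ‖(1:ω)‖`. Given
`Y ≥ Δ ≥ c` and the prime `𝔭` with the three 0-cycle bounds and `P 𝔭 ⌊c₁Δ⌋`: the transfer
yields a zero at projective distance `ρ ≤ exp(−(Δ h(𝔭) + Y deg 𝔭)/(2M))`;
`affine_near_of_projDist_le` and the dictionary give the point `(b₁/b₀, …, b_t/b₀) ∈ Kᵗ`, the
embedding and the budgets (landed bookkeeping `PointDatum.*`).
[cite: NesterenkoPhilippon2001, Ch. 3 Prop. 4.4 (p. 38); Ch. 4 §4 (p. 61)] -/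
theorem main_of_sharpWith (t : ℕ) (ht : 1 ≤ t) (hdict : ZeroDimDictionary)
    (P : Ideal (Rx t) → ℕ → Prop)
    (hsharp : ∃ C : ℝ, 0 < C ∧ ∃ ℓ₀ : ℕ, ∀ ℓ : ℕ, ℓ₀ ≤ ℓ → ∃ C' : ℝ, 0 < C' ∧
      ∀ (𝔭 : Ideal (Rx t)) (δ : ℕ) (ω : Fin t → ℂ), 𝔭.IsPrime →
        𝔭.IsHomogeneous (homogeneousSubmodule (Fin (t + 1)) ℚ) → IsUnmixedOfRank 𝔭 1 → P 𝔭 δ →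
        ∃ β ∈ projZeros 𝔭,
          projDist (Fin.cons 1 ω) β ^ ℓ ≤
            iabs 𝔭 1 (Fin.cons 1 ω) *
              Real.exp (C * δ * iheight 𝔭 1 / (ℓ : ℝ) ^ (1 / (t : ℝ)) +
                C' * ideg 𝔭 1 *
                  ((δ + 1) * (Real.log (2 + ‖ω‖) + 1) + Real.log ((ideg 𝔭 1 : ℝ) + 1))))
    (ω : Fin t → ℂ) (c₁ : ℝ) (hc₁ : 1 ≤ c₁) :
    ∃ lam : ℝ, 1 ≤ lam ∧ ∃ c : ℝ, c₁ ≤ c ∧ ∀ Δ Y : ℝ, c ≤ Δ → Δ ≤ Y →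
      ∀ 𝔭 : Ideal (Rx t), 𝔭.IsPrime → 𝔭.IsHomogeneous (homogeneousSubmodule (Fin (t + 1)) ℚ) →
        IsUnmixedOfRank 𝔭 1 → (ideg 𝔭 1 : ℝ) ≤ (c₁ * Δ) ^ t →
        iheight 𝔭 1 ≤ c₁ * (lam * Y) * Δ ^ (t - 1) →
        iabs 𝔭 1 (Fin.cons 1 ω) ≤ Real.exp (-((Δ * iheight 𝔭 1 + lam * Y * ideg 𝔭 1) / c₁)) →
        P 𝔭 ⌊c₁ * Δ⌋₊ →
        ∃ (K : Type) (_ : Field K) (_ : NumberField K) (β : Fin t → K) (σ : K →+* ℂ),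
          (Module.finrank ℚ K : ℝ) ≤ (c * Δ) ^ t ∧
          Height.logHeight (Fin.cons (1 : K) β : Fin (t + 1) → K) ≤ c * Y * Δ ^ (t - 1) ∧
          ‖(fun j => σ (β j)) - ω‖ ≤
            Real.exp (-((Δ * Height.logHeight (Fin.cons (1 : K) β : Fin (t + 1) → K) +
              Y * Module.finrank ℚ K) / c)) := by
  classical
  -- constants attached to `t`, `ω` and `c₁`
  obtain ⟨cd, hcd, hdict⟩ := hdict t ht
  obtain ⟨Cs, hCs, ℓ₀, hsharp⟩ := hsharp
  have hc₁0 : 0 < c₁ := lt_of_lt_of_le one_pos hc₁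
  set ω₁ : Fin (t + 1) → ℂ := Fin.cons 1 ω with hω₁def
  set Θ : ℝ := ‖ω₁‖ with hΘdef
  have hΘ : 1 ≤ Θ := one_le_norm_cons_one ω
  set L : ℝ := Real.log (2 + ‖ω‖) with hLdef
  have hL : 0 ≤ L := Real.log_nonneg (by linarith [norm_nonneg ω])
  set ℓ : ℕ := max ℓ₀ (max 1 ⌈(2 * c₁ * Cs * c₁) ^ t⌉₊) with hℓdef
  have hℓ1 : 1 ≤ ℓ := le_trans (le_max_left _ _) (le_max_right _ _)
  have hℓceil : ⌈(2 * c₁ * Cs * c₁) ^ t⌉₊ ≤ ℓ := le_trans (le_max_right _ _) (le_max_right _ _)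
  obtain ⟨C', hC', hsharp⟩ := hsharp ℓ (le_max_left _ _)
  set lam : ℝ := max 1 (2 * c₁ * C' * ((t + 2) * c₁) * (L + 1)) with hlamdef
  have hlam1 : 1 ≤ lam := le_max_left _ _
  set M : ℝ := c₁ * ℓ with hMdef
  have hM : 0 < M := by positivity
  have hlog0 : 0 ≤ Real.log (2 * Θ ^ 2) := Real.log_nonneg (by nlinarith)
  -- the constant of the datum at `ω`
  set c : ℝ := c₁ + (c₁ * lam + cd * c₁ ^ t) + 4 * M * (cd + 1) + 4 * M * Real.log (2 * Θ ^ 2)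
    with hcdef
  have n2 : 0 ≤ c₁ * lam + cd * c₁ ^ t := by positivity
  have n3 : 0 ≤ 4 * M * (cd + 1) := by positivity
  have n4 : 0 ≤ 4 * M * Real.log (2 * Θ ^ 2) := by positivity
  have hc_h : c₁ * lam + cd * c₁ ^ t ≤ c := by linarith
  have hc_a1 : 4 * M * (cd + 1) ≤ c := by linarith
  have hc_a2 : 4 * M * Real.log (2 * Θ ^ 2) ≤ c := by linarith
  have hcc₁ : c₁ ≤ c := by linarith
  have hc1 : 1 ≤ c := hc₁.trans hcc₁
  have hc0 : 0 < c := lt_of_lt_of_le one_pos hc1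
  refine ⟨lam, hlam1, c, hcc₁, fun Δ Y hΔ hY 𝔭 h𝔭prime h𝔭hom h𝔭unm hdeg hh𝔭 habs hclause => ?_⟩
  have hΔ1 : 1 ≤ Δ := hc1.trans hΔ
  have hΔ0 : 0 ≤ Δ := by linarith
  have hY0 : 0 ≤ Y := by linarith
  have hh𝔭0 : 0 ≤ iheight 𝔭 1 := height_nonneg _
  have hD1 : (1 : ℝ) ≤ ideg 𝔭 1 := by
    exact_mod_cast Literature.Barriers.Schanuel.one_le_ideg_of_isPrime
      NesterenkoPhilippon2001_ch3_prop_4_4_holds le_rfl ht h𝔭prime h𝔭hom h𝔭unm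
  -- the transfer at `δ = ⌊c₁Δ⌋`
  obtain ⟨β, hβ, hρℓ⟩ := hsharp 𝔭 ⌊c₁ * Δ⌋₊ ω h𝔭prime h𝔭hom h𝔭unm hclause
  set ρ : ℝ := projDist ω₁ β with hρdef
  have hρ0 : 0 ≤ ρ := projDist_nonneg _ _
  set X : ℝ := Δ * iheight 𝔭 1 + Y * ideg 𝔭 1 with hXdef
  have hXc : c ≤ X := by
    have e1 : Y ≤ Y * ideg 𝔭 1 := le_mul_of_one_le_right hY0 hD1
    have e2 : 0 ≤ Δ * iheight 𝔭 1 := by positivity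
    linarith
  have hρA : ρ ^ ℓ ≤ Real.exp (-(X / (2 * c₁))) := by
    have hδ : (⌊c₁ * Δ⌋₊ : ℝ) ≤ c₁ * Δ := Nat.floor_le (by positivity)
    have hq : 2 * c₁ * Cs * c₁ ≤ (ℓ : ℝ) ^ (1 / (t : ℝ)) :=
      PointDatum.le_rpow_of_ceil_pow_le (by positivity) ht hℓceil
    have hE := PointDatum.transfer_exponent_le (A := c₁) (h := iheight 𝔭 1)
      (D := (ideg 𝔭 1 : ℝ)) (Y := Y) (lam := lam) hCs hC' hc₁0 hc₁ hΔ1 hY hL hh𝔭0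
      (Nat.cast_nonneg _) hδ
      (PointDatum.log_add_one_le (Nat.cast_nonneg _) (by positivity) ht hdeg) hq
      (le_max_right _ _)
    refine hρℓ.trans ?_
    calc iabs 𝔭 1 ω₁ * Real.exp (Cs * ⌊c₁ * Δ⌋₊ * iheight 𝔭 1 / (ℓ : ℝ) ^ (1 / (t : ℝ)) +
          C' * ideg 𝔭 1 * ((⌊c₁ * Δ⌋₊ + 1) * (L + 1) + Real.log ((ideg 𝔭 1 : ℝ) + 1)))
        ≤ Real.exp (-((Δ * iheight 𝔭 1 + lam * Y * ideg 𝔭 1) / c₁)) *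
            Real.exp (Δ * iheight 𝔭 1 / (2 * c₁) + lam * Y * ideg 𝔭 1 / (2 * c₁)) :=
          mul_le_mul habs (exp_le_exp.mpr hE) (exp_pos _).le (exp_pos _).le
      _ = Real.exp (-((Δ * iheight 𝔭 1 + lam * Y * ideg 𝔭 1) / (2 * c₁))) := by
          rw [← exp_add]
          congr 1
          field_simp
          ring
      _ ≤ Real.exp (-(X / (2 * c₁))) := by
          rw [exp_le_exp, neg_le_neg_iff, hXdef]
          refine div_le_div_of_nonneg_right ?_ (by positivity)
          have : Y * ideg 𝔭 1 ≤ lam * Y * ideg 𝔭 1 := by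
            rw [mul_assoc]
            exact le_mul_of_one_le_left (by positivity) hlam1
          linarith
  have hρM : ρ ≤ Real.exp (-(X / (2 * M))) := by
    have := PointDatum.le_exp_of_pow_le hρ0 hℓ1 (by positivity) hρA
    have e : 2 * c₁ * (ℓ : ℝ) = 2 * M := by rw [hMdef]; ring
    rwa [e] at this
  obtain ⟨hacc, hhalf⟩ := PointDatum.accuracy_le hΘ hM hcd.le hc_a1 hc_a2 hXc
  -- the close zero is affine-near
  obtain ⟨hβ0, -, hnear⟩ :=
    affine_near_of_projDist_le ω hβ.1 ((mul_le_mul_of_nonneg_right hρM (by positivity)).trans hhalf)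
  -- the dictionary: `β = l · σ(b)`, `K = ℚ(b)`, output point `b' = (b₁/b₀, …, b_t/b₀)`
  obtain ⟨K, _instF, _instNF, b, -, hzeros, -, hfin, hhb, -, -⟩ := hdict 𝔭 h𝔭prime h𝔭hom h𝔭unm
  obtain ⟨-, σ, l, hβeq⟩ := (hzeros β).mp hβ
  have hβ0' : β 0 = l * σ (b 0) := by rw [hβeq]
  have hl : l ≠ 0 := fun h => hβ0 (by rw [hβ0', h, zero_mul])
  have hb00 : b 0 ≠ 0 := fun h => hβ0 (by rw [hβ0', h, map_zero, mul_zero])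
  set b' : Fin t → K := fun j => b j.succ / b 0 with hb'def
  have hσb' : ∀ j : Fin t, σ (b' j) = β j.succ / β 0 := by
    intro j
    have e1 : β j.succ = l * σ (b j.succ) := by rw [hβeq]
    rw [hb'def, map_div₀, e1, hβ0', mul_div_mul_left _ _ hl]
  have hcons : (Fin.cons (1 : K) b' : Fin (t + 1) → K) = (b 0)⁻¹ • b := by
    funext i
    refine Fin.cases ?_ (fun j => ?_) i
    · simp [hb00]
    · simp [hb'def, div_eq_inv_mul]
  have hheight : Height.logHeight (Fin.cons (1 : K) b' : Fin (t + 1) → K) = Height.logHeight b := by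
    rw [hcons, Height.logHeight_smul_eq_logHeight _ (inv_ne_zero hb00)]
  have hfinR : (Module.finrank ℚ K : ℝ) = ideg 𝔭 1 := by exact_mod_cast hfin
  refine ⟨K, _instF, _instNF, b', σ, ?_, ?_, ?_⟩
  · -- degree budget
    rw [hfinR]
    exact hdeg.trans (pow_le_pow_left₀ (by positivity) (mul_le_mul_of_nonneg_right hcc₁ hΔ0) t)
  · -- height budget
    rw [hheight]
    exact PointDatum.height_budget_le ht hc₁ hcd.le hΔ1 hY hhb hh𝔭 hdeg hc_h
  · -- accuracy
    rw [hheight, hfinR]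
    have hsup : ‖(fun j => σ (b' j)) - ω‖ ≤ 2 * Θ ^ 2 * ρ := by
      refine (pi_norm_le_iff_of_nonneg (by positivity)).mpr fun j => ?_
      simp only [Pi.sub_apply, hσb']
      exact hnear j
    have hnum : Δ * Height.logHeight b + Y * ideg 𝔭 1 ≤ (cd + 1) * X := by
      have e1 : Δ * Height.logHeight b ≤ Δ * (iheight 𝔭 1 + cd * ideg 𝔭 1) :=
        mul_le_mul_of_nonneg_left hhb hΔ0
      have e2 : Δ * (cd * ideg 𝔭 1) ≤ Y * (cd * ideg 𝔭 1) :=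
        mul_le_mul_of_nonneg_right hY (by positivity)
      have e3 : 0 ≤ cd * (Δ * iheight 𝔭 1) := by positivity
      rw [hXdef]
      linarith
    calc ‖(fun j => σ (b' j)) - ω‖ ≤ 2 * Θ ^ 2 * ρ := hsup
      _ ≤ 2 * Θ ^ 2 * Real.exp (-(X / (2 * M))) := mul_le_mul_of_nonneg_left hρM (by positivity)
      _ ≤ Real.exp (-((cd + 1) * X / c)) := hacc
      _ ≤ Real.exp (-((Δ * Height.logHeight b + Y * ideg 𝔭 1) / c)) := by
          rw [exp_le_exp, neg_le_neg_iff]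
          exact div_le_div_of_nonneg_right hnum hc0.le

/-- **The per-scale good-orbit transfer under the near-clause (curried form of the stub).**
`main_of_sharpWith` with `P` the near-clause `deg 𝔭 + K₀ · dim(ℚ[x]_δ ∩ 𝔭) ≤ K₀ · dim ℚ[x]_δ`
and the transfer supplied by `SharpClosestPointDeficient` at `(t, K₀)`.
[cite: NesterenkoPhilippon2001, Ch. 3 Prop. 4.4 (p. 38); Ch. 4 §4 (p. 61)] -/
theorem main (t : ℕ) (ht : 1 ≤ t) (hdict : ZeroDimDictionary)
    (hsharp : SharpClosestPointDeficient) (ω : Fin t → ℂ) (c₁ : ℝ) (K₀ : ℕ) (hc₁ : 1 ≤ c₁)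
    (hK₀ : 1 ≤ K₀) :
    ∃ lam : ℝ, 1 ≤ lam ∧ ∃ c : ℝ, c₁ ≤ c ∧ ∀ Δ Y : ℝ, c ≤ Δ → Δ ≤ Y →
      ∀ 𝔭 : Ideal (Rx t), 𝔭.IsPrime → 𝔭.IsHomogeneous (homogeneousSubmodule (Fin (t + 1)) ℚ) →
        IsUnmixedOfRank 𝔭 1 → (ideg 𝔭 1 : ℝ) ≤ (c₁ * Δ) ^ t →
        iheight 𝔭 1 ≤ c₁ * (lam * Y) * Δ ^ (t - 1) →
        iabs 𝔭 1 (Fin.cons 1 ω) ≤ Real.exp (-((Δ * iheight 𝔭 1 + lam * Y * ideg 𝔭 1) / c₁)) →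
        ideg 𝔭 1 + K₀ * Module.finrank ℚ ↥(homogeneousSubmodule (Fin (t + 1)) ℚ ⌊c₁ * Δ⌋₊ ⊓
            𝔭.restrictScalars ℚ) ≤
          K₀ * Module.finrank ℚ ↥(homogeneousSubmodule (Fin (t + 1)) ℚ ⌊c₁ * Δ⌋₊) →
        ∃ (K : Type) (_ : Field K) (_ : NumberField K) (β : Fin t → K) (σ : K →+* ℂ),
          (Module.finrank ℚ K : ℝ) ≤ (c * Δ) ^ t ∧
          Height.logHeight (Fin.cons (1 : K) β : Fin (t + 1) → K) ≤ c * Y * Δ ^ (t - 1) ∧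
          ‖(fun j => σ (β j)) - ω‖ ≤
            Real.exp (-((Δ * Height.logHeight (Fin.cons (1 : K) β : Fin (t + 1) → K) +
              Y * Module.finrank ℚ K) / c)) :=
  main_of_sharpWith t ht hdict
    (fun 𝔭 δ =>
      ideg 𝔭 1 + K₀ * Module.finrank ℚ ↥(homogeneousSubmodule (Fin (t + 1)) ℚ δ ⊓
          𝔭.restrictScalars ℚ) ≤
        K₀ * Module.finrank ℚ ↥(homogeneousSubmodule (Fin (t + 1)) ℚ δ))
    (hsharp t ht K₀ hK₀) ω c₁ hc₁

end PointDatumNear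

/-- **Stub `pointDatum_of_nearClause` — the per-scale good-orbit transfer under the near-clause
(any `t ≥ 1`): `ZeroDimDictionary → SharpClosestPointDeficient →` for every `ω ∈ ℂᵗ`, `c₁ ≥ 1`,
`K₀ ≥ 1` there are `λ ≥ 1`, `c ≥ c₁` such that for `Y ≥ Δ ≥ c`, ONE homogeneous prime `𝔭` of
rank `1` with the 0-cycle bounds at the boosted scale `(Δ, λY)` whose zeros impose at least
`deg 𝔭 / K₀` conditions on the forms of degree `⌊c₁Δ⌋` yields a `PointAPAbsAt t`-datum at
`(Δ, Y)`.** Short wrapper around `PointDatumNear.main` (transfer at `δ = ⌊c₁Δ⌋`,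
projective-to-affine chart, 0-dimensional dictionary, budgets).
[cite: NesterenkoPhilippon2001, Ch. 3 Prop. 4.4 (p. 38); Ch. 4 §4 (p. 61)] -/
theorem pointDatum_of_nearClause : ∀ t : ℕ, 1 ≤ t → ZeroDimDictionary → SharpClosestPointDeficient → ∀ (ω : Fin t → ℂ) (c₁ : ℝ) (K₀ : ℕ), 1 ≤ c₁ → 1 ≤ K₀ → ∃ lam : ℝ, 1 ≤ lam ∧ ∃ c : ℝ, c₁ ≤ c ∧ ∀ Δ Y : ℝ, c ≤ Δ → Δ ≤ Y → ∀ 𝔭 : Ideal (Rx t), 𝔭.IsPrime → 𝔭.IsHomogeneous (homogeneousSubmodule (Fin (t + 1)) ℚ) → IsUnmixedOfRank 𝔭 1 → (ideg 𝔭 1 : ℝ) ≤ (c₁ * Δ) ^ t → iheight 𝔭 1 ≤ c₁ * (lam * Y) * Δ ^ (t - 1) → iabs 𝔭 1 (Fin.cons 1 ω) ≤ Real.exp (-((Δ * iheight 𝔭 1 + lam * Y * ideg 𝔭 1) / c₁)) → ideg 𝔭 1 + K₀ * Module.finrank ℚ ↥(homogeneousSubmodule (Fin (t + 1)) ℚ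 ⌊c₁ * Δ⌋₊ ⊓ 𝔭.restrictScalars ℚ) ≤ K₀ * Module.finrank ℚ ↥(homogeneousSubmodule (Fin (t + 1)) ℚ ⌊c₁ * Δ⌋₊) → ∃ (K : Type) (_ : Field K) (_ : NumberField K) (β : Fin t → K) (σ : K →+* ℂ), (Module.finrank ℚ K : ℝ) ≤ (c * Δ) ^ t ∧ Height.logHeight (Fin.cons (1 : K) β : Fin (t + 1) → K) ≤ c * Y * Δ ^ (t - 1) ∧ ‖(fun j => σ (β j)) - ω‖ ≤ Real.exp (-((Δ * Height.logHeight (Fin.cons (1 : K) β : Fin (t + 1) → K) + Y * Module.finrank ℚ K) / c)) := by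
  intro t ht hdict hsharp ω c₁ K₀ hc₁ hK₀
  exact PointDatumNear.main t ht hdict hsharp ω c₁ K₀ hc₁ hK₀

end Summit.Schanuel.Schanuel.Cruxes.ApproximationProperty.OrbitInterpolationDeterminant

end
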